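import Mathlib
import Summits.Ventures.PercRepro2.HMFMinEnd

/-!
# The crux from (MIN-END): induction on the edges of weight strictly between `0` and `1`
(blind cell PercRepro2, night-1 g18; NIGHT1-G18.md §6)

`MinEndHCovEdge_all` is the general-edge form of the candidate row (MIN-END): along EVERY edge
`f` (at `a₃` or not) the cubic `q ↦ Gc(p[f ↦ q])` attains its minimum over `[0, 1]` at an endpoint.
`Deterministic_HCov_all` is the base: (HCOV) on every weight vector with all weights in `{0, 1}`
(there every mass is an indicator and `Gc = 0`; not formalised here).

* **`HCov_of_minEnd_induction`**: for a fixed instance, (HCOV) follows from (MIN-END) at its edges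
  and (HCOV) at the deterministic vectors, by strong induction on the number of edges of weight in
  `(0, 1)` — each step deletes an edge (`q = 0`) or makes it sure (`q = 1`);
* **`HCov_all_of_minEnd`**: `MinEndHCovEdge_all R → Deterministic_HCov_all R → CovForm.HCov_all R`
  — the crux of record from the candidate row and the deterministic base.

Own code; standard axioms.
-/

namespace Summit.Ventures.PercRepro2

open UnionCluster CovForm

namespace MinEnd

section Row

variable (R : Type*) [Field R] [LinearOrder R] [IsStrictOrderedRing R]

/-- **(MIN-END) for the covariance form along every edge** (the general-edge form of
`MinEndHCov_all`). -/
def MinEndHCovEdge_all : Prop :=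
  ∀ (V E : Type) [Fintype V] [DecidableEq V] [Fintype E] [DecidableEq E]
    (ends : E → Sym2 V) (p : E → R), IsProbVec p →
    ∀ (o a₁ a₂ a₃ b : V) (f : E),
      min (Gc (Function.update p f 0) ends o a₁ a₂ a₃ b)
          (Gc (Function.update p f 1) ends o a₁ a₂ a₃ b) ≤ Gc p ends o a₁ a₂ a₃ b

/-- **The deterministic base**: (HCOV) whenever every weight is `0` or `1`. -/
def Deterministic_HCov_all : Prop :=
  ∀ (V E : Type) [Fintype V] [DecidableEq V] [Fintype E] [DecidableEq E]
    (ends : E → Sym2 V) (p : E → R), (∀ e, p e = 0 ∨ p e = 1) →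
    ∀ o a₁ a₂ a₃ b : V, HCov p ends o a₁ a₂ a₃ b

end Row

section Induction

variable {V : Type*} {E : Type*} [Fintype E] [DecidableEq E] [Fintype V] [DecidableEq V]
  {R : Type*} [Field R] [LinearOrder R] [IsStrictOrderedRing R]

variable (ends : E → Sym2 V) (o a₁ a₂ a₃ b : V)

/-- The edges of weight strictly between `0` and `1`. -/
noncomputable def fractional (p : E → R) : Finset E :=
  Finset.univ.filter fun e => p e ≠ 0 ∧ p e ≠ 1

omit [Fintype V] [DecidableEq V] [IsStrictOrderedRing R] in
/-- Pinning an edge of `fractional p` to `c ∈ {0, 1}` removes it from the fractional set. -/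
lemma fractional_update {p : E → R} {e : E} (he : e ∈ fractional p) (c : R) (hc : c = 0 ∨ c = 1) :
    fractional (Function.update p e c) = (fractional p).erase e := by
  ext e'
  simp only [fractional, Finset.mem_filter, Finset.mem_univ, true_and, Finset.mem_erase]
  by_cases h : e' = e
  · subst h
    simp only [Function.update_self, ne_eq, not_true_eq_false, false_and, iff_false, not_and]
    rcases hc with hc | hc <;> simp [hc]
  · simp [h]

omit [DecidableEq E] [Fintype V] [DecidableEq V] [IsStrictOrderedRing R] in
/-- A vector with no fractional edge is deterministic. -/
lemma deterministic_of_fractional_empty {p : E → R} (h : fractional p = ∅) :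
    ∀ e, p e = 0 ∨ p e = 1 := by
  intro e
  by_contra hne
  rw [not_or] at hne
  have : e ∈ fractional p := by
    simp only [fractional, Finset.mem_filter, Finset.mem_univ, true_and]
    exact hne
  rw [h] at this
  exact Finset.notMem_empty e this

omit [Fintype V] [DecidableEq V] in
/-- **(HCOV) by induction on the fractional edges**: (MIN-END) at every edge of every instance on
`(V, E, ends)` and (HCOV) at every deterministic vector give (HCOV) at every admissible vector. -/
theorem HCov_of_minEnd_induction
    (hmin : ∀ (p : E → R), IsProbVec p → ∀ f : E,
      min (Gc (Function.update p f 0) ends o a₁ a₂ a₃ b)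
          (Gc (Function.update p f 1) ends o a₁ a₂ a₃ b) ≤ Gc p ends o a₁ a₂ a₃ b)
    (hbase : ∀ (p : E → R), (∀ e, p e = 0 ∨ p e = 1) → HCov p ends o a₁ a₂ a₃ b)
    (p : E → R) (hp : IsProbVec p) : HCov p ends o a₁ a₂ a₃ b := by
  -- strong induction on the number of fractional edges
  suffices key : ∀ (n : ℕ) (p : E → R), IsProbVec p → (fractional p).card = n →
      HCov p ends o a₁ a₂ a₃ b from key _ p hp rfl
  intro n
  induction n using Nat.strong_induction_on with
  | _ n ih =>
    intro p hp hcard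
    by_cases hF : fractional p = ∅
    · exact hbase p (deterministic_of_fractional_empty hF)
    · obtain ⟨e, he⟩ := Finset.nonempty_iff_ne_empty.2 hF
      have hcard' : ((fractional p).erase e).card < n := by
        rw [← hcard]
        exact Finset.card_erase_lt_of_mem he
      have h0 : HCov (Function.update p e 0) ends o a₁ a₂ a₃ b :=
        ih _ hcard' _ (hp.update e le_rfl zero_le_one)
          (by rw [fractional_update he 0 (Or.inl rfl)])
      have h1 : HCov (Function.update p e 1) ends o a₁ a₂ a₃ b :=
        ih _ hcard' _ (hp.update e zero_le_one le_rfl)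
          (by rw [fractional_update he 1 (Or.inr rfl)])
      exact HCov_of_minEnd p ends o a₁ a₂ a₃ b e (hmin p hp e) h0 h1

end Induction

section Closure

variable (R : Type*) [Field R] [LinearOrder R] [IsStrictOrderedRing R]

/-- **The crux of record from (MIN-END) and the deterministic base**:
`MinEndHCovEdge_all R → Deterministic_HCov_all R → CovForm.HCov_all R`. -/
theorem HCov_all_of_minEnd (hmin : MinEndHCovEdge_all R) (hbase : Deterministic_HCov_all R) :
    CovForm.HCov_all R := by
  intro V E _ _ _ _ ends p hp o a₁ a₂ a₃ b _ _ _ _ _ _ _ _ _ _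
  exact HCov_of_minEnd_induction ends o a₁ a₂ a₃ b
    (fun p hp f => hmin V E ends p hp o a₁ a₂ a₃ b f)
    (fun p hdet => hbase V E ends p hdet o a₁ a₂ a₃ b) p hp

end Closure

end MinEnd

end Summit.Ventures.PercRepro2
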